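import Mathlib.Computability.PartrecCode
import Literature.ModelTheory.ProofTheory.SentenceCodes
import Literature.ModelTheory.ExponentialFields.DecidableTheoryProofs

/-!
# Craig's theorem: an r.e. set of axioms is computably axiomatizable

We prove, for Mathlib's Gödel numbering and the notions of
`Literature/ModelTheory/ExponentialFields/DecidableTheory.lean` (C9), the classical observation of
W. Craig (*On axiomatizability within a system*, J. Symbolic Logic 18 (1953) 30–32; Enderton,
*A Mathematical Introduction to Logic*, §3.5, Exercise / "Craig's trick"): in a recursively
presented language, a theory whose set of axioms is recursively enumerable
(`Theory.IsREAxioms`) has a *recursive* set of axioms with the same consequences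
(`Theory.IsComputablyAxiomatizable`) —
`FirstOrder.Language.Theory.IsREAxioms.isComputablyAxiomatizable`.

## Proof (Craig's trick, with `⊤ ⟹ ·` as padding)

Fix a partial recursive code `c` semi-deciding the Gödel numbers of the axioms, and let `A`
consist of the sentences `⊤ ⟹ (⊤ ⟹ ⋯ (⊤ ⟹ φ))` with `k` paddings such that `c` halts on
`⌜φ⌝` within `k` steps (`Nat.Partrec.Code.evaln k`). Each member of `A` is equivalent to an
axiom and each axiom is equivalent to a member of `A`, so the consequences agree; and membership
in `A` is decidable on Gödel numbers: the letters of the padding are the fixed prefix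
`3, 3, 11, 11` (`formulaLetters_padTop`), so one tries every `k` up to the length, checks that
the rest is the letter string of a sentence (`sentenceLettersB`, `SentenceCodes.lean`) and runs
`c` for `k` steps.

## Main statements

* `BoundedFormula.padTop`, `realize_padTop`, `formulaLetters_padTop` [folklore];
* `Theory.IsREAxioms.isComputablyAxiomatizable` [cite: Craig1953].
-/

namespace FirstOrder.Language

open Literature.ModelTheory.ProofTheory.PreFOL Encodable Denumerable Nat.Partrec

variable {L : Language}

namespace BoundedFormula

variable {α : Type*} {n : ℕ}

/-- `padTop k φ = ⊤ ⟹ (⊤ ⟹ ⋯ (⊤ ⟹ φ))` with `k` paddings (Craig's trick). [folklore] -/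
def padTop : ℕ → L.BoundedFormula α n → L.BoundedFormula α n
  | 0, φ => φ
  | k + 1, φ => (⊤ : L.BoundedFormula α n).imp (padTop k φ)

/-- Padding does not change the meaning. [folklore] -/
@[simp] theorem realize_padTop {M : Type*} [L.Structure M] {v : α → M} {xs : Fin n → M} :
    ∀ {k : ℕ} {φ : L.BoundedFormula α n}, (padTop k φ).Realize v xs ↔ φ.Realize v xs
  | 0, _ => Iff.rfl
  | k + 1, φ => by
    rw [padTop, realize_imp, realize_top, realize_padTop]
    exact ⟨fun h => h trivial, fun h _ => h⟩

end BoundedFormula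

/-- Padding does not change the truth of a sentence. [folklore] -/
@[simp] theorem Sentence.realize_padTop {M : Type*} [L.Structure M] {k : ℕ} {φ : L.Sentence} :
    M ⊨ BoundedFormula.padTop k φ ↔ M ⊨ φ :=
  BoundedFormula.realize_padTop

end FirstOrder.Language

namespace Literature.ModelTheory.ProofTheory.PreFOL

open FirstOrder FirstOrder.Language Encodable Denumerable Nat.Partrec Nat.Partrec.Code

/-! ### The letters of the padding -/

/-- The letters of `k` paddings `⊤ ⟹ ·` at depth `0`: `3, 3, 11, 11` repeated `k` times. [folklore] -/
def padLetters : ℕ → List ℕ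
  | 0 => []
  | k + 1 => 3 :: 3 :: 11 :: 11 :: padLetters k

/-- The padding has `4 k` letters. [folklore] -/
@[simp] theorem length_padLetters : ∀ k : ℕ, (padLetters k).length = 4 * k
  | 0 => rfl
  | k + 1 => by rw [padLetters]; simp [length_padLetters k]; omega

section Letters

variable {L : Language} [Encodable (Σ i, L.Functions i)] [Encodable (Σ i, L.Relations i)]

/-- The letters of a padded sentence: the padding letters, then the letters of the sentence. [folklore] -/
theorem formulaLetters_padTop (φ : L.Sentence) :
    ∀ k : ℕ, formulaLetters (BoundedFormula.padTop k φ) = padLetters k ++ formulaLetters φ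
  | 0 => rfl
  | k + 1 => by
    rw [BoundedFormula.padTop, formulaLetters_imp, formulaLetters_padTop φ k,
      show (⊤ : L.BoundedFormula Empty 0) = BoundedFormula.falsum.imp BoundedFormula.falsum from rfl,
      formulaLetters_imp, formulaLetters_falsum, padLetters]
    rfl

end Letters

/-! ### Craig's axiom set and its recogniser -/

section Craig

variable {L : Language} [Encodable (Σ i, L.Functions i)] [Encodable (Σ i, L.Relations i)]

variable (L) in
/-- Craig's axiom set for the code `c`: the paddings `padTop k φ` of the sentences `φ` on whose
Gödel number `c` halts within `k` steps. [folklore] -/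
def craigSet (c : Code) : L.Theory :=
  {χ | ∃ (k : ℕ) (φ : L.Sentence), χ = BoundedFormula.padTop k φ ∧ (evaln k c φ.godelNumber).isSome}

/-- The recogniser of the Gödel letters of Craig's axiom set (arity oracles `oF`, `oR`). [folklore] -/
def craigB (oF oR : ℕ → Option ℕ) (c : Code) (l : List ℕ) : Bool :=
  (List.range (l.length + 1)).foldl (fun b k => b ||
    (decide (l.take (4 * k) = padLetters k) && sentenceLettersB oF oR (l.drop (4 * k)) &&
      (evaln k c (encode (l.drop (4 * k)))).isSome)) false

/-- A left fold of `||` computes `List.any`. [folklore] -/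
theorem foldl_or_eq {α : Type*} (p : α → Bool) :
    ∀ (l : List α) (b : Bool), l.foldl (fun b z => b || p z) b = (b || l.any p)
  | [], b => by simp
  | x :: l, b => by rw [List.foldl_cons, foldl_or_eq p l, List.any_cons, Bool.or_assoc]

/-- What the recogniser accepts. [folklore] -/
theorem craigB_eq_true_iff {oF oR : ℕ → Option ℕ} {c : Code} {l : List ℕ} :
    craigB oF oR c l = true ↔ ∃ k, k ≤ l.length ∧ l.take (4 * k) = padLetters k ∧
      sentenceLettersB oF oR (l.drop (4 * k)) = true ∧
      (evaln k c (encode (l.drop (4 * k)))).isSome = true := by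
  rw [craigB, foldl_or_eq, Bool.false_or, List.any_eq_true]
  simp only [List.mem_range, Nat.lt_succ_iff, Bool.and_eq_true, decide_eq_true_eq]
  constructor
  · rintro ⟨k, hk, ⟨h1, h2⟩, h3⟩; exact ⟨k, hk, h1, h2, h3⟩
  · rintro ⟨k, hk, h1, h2, h3⟩; exact ⟨k, hk, ⟨h1, h2⟩, h3⟩

/-- **Correctness of the recogniser** (for the arity tables of `L`). [folklore] -/
theorem exists_mem_craigSet_iff (c : Code) (n : ℕ) :
    (∃ χ ∈ craigSet L c, χ.godelNumber = n) ↔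
      craigB (arityF L) (arityR L) c (ofNat (List ℕ) n) = true := by
  rw [craigB_eq_true_iff]
  constructor
  · rintro ⟨χ, ⟨k, φ, rfl, hev⟩, rfl⟩
    rw [godelNumber_eq, ofNat_encode, formulaLetters_padTop]
    refine ⟨k, by simp; omega, take_append_of_length_eq _ (length_padLetters k), ?_, ?_⟩
    · rw [drop_append_of_length_eq _ (length_padLetters k)]
      exact sentenceLettersB_iff.2 ⟨φ, rfl⟩
    · rw [drop_append_of_length_eq _ (length_padLetters k), ← godelNumber_eq]
      exact hev
  · rintro ⟨k, -, htake, hsent, hev⟩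
    obtain ⟨φ, hφ⟩ := sentenceLettersB_iff.1 hsent
    refine ⟨BoundedFormula.padTop k φ, ⟨k, φ, rfl, ?_⟩, ?_⟩
    · rwa [godelNumber_eq, hφ]
    · rw [godelNumber_eq, formulaLetters_padTop, hφ, ← htake, List.take_append_drop, encode_ofNat]

/-- Members of Craig's set are paddings of sentences on whose Gödel number the code halts. [folklore] -/
theorem mem_craigSet_iff {c : Code} {χ : L.Sentence} :
    χ ∈ craigSet L c ↔ ∃ (k : ℕ) (φ : L.Sentence),
      χ = BoundedFormula.padTop k φ ∧ (evaln k c φ.godelNumber).isSome :=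
  Iff.rfl

/-! ### Computability of the recogniser -/

/-- `padLetters` is primitive recursive. [folklore] -/
theorem primrec_padLetters : Primrec padLetters := by
  have h : Primrec₂ fun (_ : ℕ) (l : List ℕ) => 3 :: 3 :: 11 :: 11 :: l :=
    (Primrec.list_cons.comp (Primrec.const 3) (Primrec.list_cons.comp (Primrec.const 3)
      (Primrec.list_cons.comp (Primrec.const 11) (Primrec.list_cons.comp (Primrec.const 11)
        Primrec.snd)))).to₂
  refine (Primrec.nat_rec₁ [] h).of_eq fun k => ?_
  induction k with
  | zero => rfl
  | succ k ih => rw [padLetters, ← ih]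

/-- The table-relative recogniser is primitive recursive in `(τF, τR, letters)`. [folklore] -/
theorem primrec_craigB (c : Code) :
    Primrec fun q : List (Option ℕ) × List (Option ℕ) × List ℕ => craigB (tab q.1) (tab q.2.1) c q.2.2 := by
  -- the body of the fold, as a function of ((τF, τR, l), (b, k))
  have hl : Primrec fun p : (List (Option ℕ) × List (Option ℕ) × List ℕ) × (Bool × ℕ) => p.1.2.2 :=
    Primrec.snd.comp (Primrec.snd.comp Primrec.fst)
  have hk : Primrec fun p : (List (Option ℕ) × List (Option ℕ) × List ℕ) × (Bool × ℕ) => p.2.2 :=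
    Primrec.snd.comp Primrec.snd
  have hdrop : Primrec fun p : (List (Option ℕ) × List (Option ℕ) × List ℕ) × (Bool × ℕ) =>
      p.1.2.2.drop (4 * p.2.2) :=
    Primrec.list_drop.comp (Primrec.nat_mul.comp (Primrec.const 4) hk) hl
  have h1 : PrimrecPred fun p : (List (Option ℕ) × List (Option ℕ) × List ℕ) × (Bool × ℕ) =>
      p.1.2.2.take (4 * p.2.2) = padLetters p.2.2 :=
    PrimrecRel.comp Primrec.eq (Primrec.list_take.comp (Primrec.nat_mul.comp (Primrec.const 4) hk) hl)
      (primrec_padLetters.comp hk)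
  have h2' := primrec_sentenceLettersB.comp ((Primrec.fst.comp Primrec.fst).pair
    ((Primrec.fst.comp (Primrec.snd.comp Primrec.fst)).pair hdrop))
    (α := (List (Option ℕ) × List (Option ℕ) × List ℕ) × (Bool × ℕ))
  have h3' := primrec_evaln.comp ((hk.pair (Primrec.const c)).pair (Primrec.encode.comp hdrop))
  have h3 : Primrec fun p : (List (Option ℕ) × List (Option ℕ) × List ℕ) × (Bool × ℕ) =>
      (evaln p.2.2 c (encode (p.1.2.2.drop (4 * p.2.2)))).isSome :=
    Primrec.option_isSome.comp h3'
  have hbody : Primrec fun p : (List (Option ℕ) × List (Option ℕ) × List ℕ) × (Bool × ℕ) =>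
      (p.2.1 || (decide (p.1.2.2.take (4 * p.2.2) = padLetters p.2.2) &&
        sentenceLettersB (tab p.1.1) (tab p.1.2.1) (p.1.2.2.drop (4 * p.2.2)) &&
        (evaln p.2.2 c (encode (p.1.2.2.drop (4 * p.2.2)))).isSome)) :=
    Primrec.or.comp (Primrec.fst.comp Primrec.snd)
      (Primrec.and.comp (Primrec.and.comp h1.decide h2') h3)
  have h := Primrec.list_foldl (Primrec.list_range.comp (Primrec.succ.comp
    (Primrec.list_length.comp (Primrec.snd.comp Primrec.snd)))) (Primrec.const false) hbody.to₂
    (α := List (Option ℕ) × List (Option ℕ) × List ℕ)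
  exact h.of_eq fun q => rfl

/-- The recogniser only consults the oracles below the letters. [folklore] -/
theorem craigB_congr {oF oF' oR oR' : ℕ → Option ℕ} {B : ℕ} (hoF : ∀ i < B, oF i = oF' i)
    (hoR : ∀ i < B, oR i = oR' i) (c : Code) {l : List ℕ} (hl : ∀ x ∈ l, x < B) :
    craigB oF oR c l = craigB oF' oR' c l := by
  unfold craigB
  congr 1
  funext b k
  rw [sentenceLettersB_congr hoF hoR fun x hx => hl x (List.drop_subset _ _ hx)]

/-- **The recogniser with computable oracles is computable.** [folklore] -/
theorem computable_craigB {arF arR : ℕ → Option ℕ} (hF : Computable arF) (hR : Computable arR)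
    (c : Code) : Computable fun n : ℕ => craigB arF arR c (ofNat (List ℕ) n) := by
  have h1 := (primrec_craigB c).to_comp.comp (((computable_arityTable hF).comp Computable.succ).pair
      (((computable_arityTable hR).comp Computable.succ).pair (Computable.ofNat (List ℕ))))
  refine h1.of_eq fun n => ?_
  show craigB (tab (arityTable arF (n + 1))) (tab (arityTable arR (n + 1))) c (ofNat (List ℕ) n) = _
  exact craigB_congr (B := n + 1) (fun i hi => tab_arityTable_of_lt hi)
    (fun i hi => tab_arityTable_of_lt hi) c (fun x hx => Nat.lt_succ_of_lt (lt_of_mem_ofNat hx))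

end Craig

end Literature.ModelTheory.ProofTheory.PreFOL

/-! ### Craig's theorem -/

namespace FirstOrder.Language.Theory

open Literature.ModelTheory.ProofTheory.PreFOL Encodable Denumerable Nat.Partrec Nat.Partrec.Code

variable {L : Language} [Encodable (Σ i, L.Functions i)] [Encodable (Σ i, L.Relations i)]

/-- An r.e. predicate on `ℕ` is the halting set of a code, read through step-bounded
evaluation. [folklore] -/
theorem _root_.REPred.exists_code_evaln {p : ℕ → Prop} (hp : REPred p) :
    ∃ c : Code, ∀ n, p n ↔ ∃ k, (evaln k c n).isSome = true := by
  have h1 : Partrec fun n => (Part.assert (p n) fun _ => Part.some ()).map encode :=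
    Partrec.map_encode_iff.2 hp
  obtain ⟨c, hc⟩ := exists_code.1 (Partrec.nat_iff.1 h1)
  refine ⟨c, fun n => ?_⟩
  have hdom : (eval c n).Dom ↔ p n := by
    rw [hc]
    simp [Part.assert]
  rw [← hdom, Part.dom_iff_mem]
  simp only [evaln_complete, Option.isSome_iff_exists]
  exact ⟨fun ⟨y, k, hk⟩ => ⟨k, y, hk⟩, fun ⟨k, y, hk⟩ => ⟨y, k, hk⟩⟩

/-- **Craig's theorem** (Craig 1953; Enderton 2001, §3.5), relative to computable arity tables:
a theory with an r.e. set of axioms is computably axiomatizable. [cite: Craig1953] -/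
theorem IsREAxioms.isComputablyAxiomatizable_of_computable (hF : Computable (arityF L))
    (hR : Computable (arityR L)) {T : L.Theory} (h : T.IsREAxioms) :
    T.IsComputablyAxiomatizable := by
  obtain ⟨c, hc⟩ := REPred.exists_code_evaln h
  refine ⟨craigSet L c, ?_, fun ψ => ⟨fun hψ => ?_, fun hψ => ?_⟩⟩
  · -- recursiveness of Craig's set
    exact ComputablePred.computable_iff.2 ⟨_, computable_craigB hF hR c,
      funext fun n => propext (exists_mem_craigSet_iff c n)⟩
  · -- consequences of Craig's set are consequences of `T`
    refine models_of_models_theory (fun χ hχ => ?_) hψ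
    obtain ⟨k, φ, rfl, hev⟩ := hχ
    obtain ⟨φ', hφ', he⟩ := (hc _).2 ⟨k, hev⟩
    obtain rfl : φ' = φ := Sentence.godelNumber_injective he
    exact models_sentence_iff.2 fun M =>
      Sentence.realize_padTop.2 ((models_sentence_of_mem hφ').realize_sentence M)
  · -- consequences of `T` are consequences of Craig's set
    refine models_of_models_theory (fun φ hφ => ?_) hψ
    obtain ⟨k, hk⟩ := (hc _).1 ⟨φ, hφ, rfl⟩
    have hmem : BoundedFormula.padTop k φ ∈ craigSet L c := ⟨k, φ, rfl, hk⟩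
    exact models_sentence_iff.2 fun M =>
      Sentence.realize_padTop.1 ((models_sentence_of_mem hmem).realize_sentence M)

/-- **Craig's theorem** (Craig, *On axiomatizability within a system*, J. Symbolic Logic 18
(1953); Enderton 2001, §3.5): in a recursively presented language, a theory whose set of axioms
is recursively enumerable has a recursive set of axioms with the same consequences — so that
`Theory.IsREAxioms` and `Theory.IsComputablyAxiomatizable` (up to consequences) describe the same
theories. [cite: Craig1953] -/
theorem IsREAxioms.isComputablyAxiomatizable (hL : L.IsRecursivelyPresented) {T : L.Theory}
    (h : T.IsREAxioms) : T.IsComputablyAxiomatizable :=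
  h.isComputablyAxiomatizable_of_computable hL.computable_arityF hL.computable_arityR

/-- Conversely (trivially), a computably axiomatizable theory has the same consequences as an
r.e. — indeed recursive — set of axioms. [folklore] -/
theorem IsComputablyAxiomatizable.exists_isREAxioms {T : L.Theory} (h : T.IsComputablyAxiomatizable) :
    ∃ A : L.Theory, A.IsREAxioms ∧ ∀ φ : L.Sentence, A ⊨ᵇ φ ↔ T ⊨ᵇ φ := by
  obtain ⟨A, hA, hAT⟩ := h
  exact ⟨A, hA.isREAxioms, hAT⟩

end FirstOrder.Language.Theory
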